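import Summits.ValiantsHypothesis.ValiantsHypothesis.Theorems.GrenetZeonDualUnipotentThreeHalvesHeavyTopTraceFirstOrder
import Summits.ValiantsHypothesis.ValiantsHypothesis.Theorems.GrenetZeonDualUnipotentThreeHalvesLongMassNilSpaceTopImage

/-!
# `GrenetZeon.DualUnipotentThreeHalves` (stmt-ValiantsHypothesis-24318), line `slow_core`, stub (c) `SlowCore.LongMassSlowLawInv`:
# COORBIT ORTHOGONALITY of a nilpotent matrix space (Mathes / MacDonald / de Seguins Pazzis 2019, Lemma 3.1 and Claim 3.3)

Companion of ✓ `NilSpaceTopImage` (p842101).  For a linear space `V ≤ M_b(ℂ)` of nilpotent matrices (uniform index `≤ H`) and a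
vector `x`, de Seguins Pazzis (*The structured Gerstenhaber problem (II)*, LAA 569 (2019), §3.1) considers the **coorbit space**
`V^x := {f : x ⊗ f ∈ V}` of the functionals `f` whose rank-one matrix `x·fᵀ = vecMulVec x f` (the operator `y ↦ (f·y) x`) lies in `V`,
and shows with the trace lemma that `V^x` is orthogonal to `ℂx ⊕ V·x` (Lemma 3.1; the engine of MacDonald's inductive proof of
Gerstenhaber's theorem, `dim V = dim V·x + dim V^x + dim (V mod x)`).  In fact (Claim 3.3 there, stated for maximal spaces but valid
verbatim) `V^x` kills the whole POWER ORBIT of `x`.  Here, def-free, in the submodule currency of (c):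

* ★ `dotProduct_pow_mulVec_eq_zero` — COORBIT ORTHOGONALITY: `vecMulVec x f ∈ V`, `X ∈ V` ⇒ `f · (X^k x) = 0` for every `k ≥ 0`
  (`tr((x fᵀ)·X^k) = f·(X^k x)` and the first-order trace identity ✓ `HeavyTopBorderOrthogonality.trace_firstOrder_eq_zero`);
* ★ `dotProduct_derivSum_mulVec_eq_zero` — its first-order form: `f · ((Σ_{i<m} X^i Y X^{m−1−i}) x) = 0` for `X, Y ∈ V`
  (✓ `HeavyTopTraceFirstOrder.trace_mul_firstOrder_eq_zero`);
* ★★ `finrank_coorbit_add_finrank_orbit_le` — MACDONALD'S INEQUALITY: for every subspace `F` of coorbit functionals (`vecMulVec x f ∈ V` for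
  `f ∈ F`) and the orbit span `G := span({x} ∪ V·x)`: `dim F + dim G ≤ b` (`F` embeds in the dual annihilator of `G` via `dotProductEquiv`);
* ★ `dotProduct_eq_zero_of_topSpan_generated` — junction with the top-image file: coorbit functionals of `x` kill every top image
  `X^{H−1} y` that lies in `ℂx + V·x`… precisely, they kill `ℂx + V·x + Σ_X X^k x`, so under condition (C) of the Reducibility Lemma they kill
  the whole top span.

HONEST FRAMING.  Support lemmas (`--supports stmt-ValiantsHypothesis-24318`); NOT progress on (c) `SlowCore.LongMassSlowLawInv` (RESEARCH —
OPEN); closes no stub; S3, 24318, 8062 and `VP ≠ VNP` are NOT proved.  Def-free (`V^x`, `V·x` enter through hypotheses / `Submodule.span`),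
no named facts, no sorry.
[cite: deSeguinsPazzis2019StructuredGerstenhaberII, Lemma 3.1 and Claim 3.3]
-/

set_option linter.dupNamespace false
set_option autoImplicit false

noncomputable section

namespace Summit.ValiantsHypothesis.ValiantsHypothesis.Theorems.GrenetZeon.NilSpaceCoorbit

open Matrix
open scoped BigOperators
open Summit.ValiantsHypothesis.ValiantsHypothesis.Theorems.GrenetZeon.HeavyTopBorderOrthogonality (trace_firstOrder_eq_zero)
open Summit.ValiantsHypothesis.ValiantsHypothesis.Theorems.GrenetZeon.HeavyTopTraceFirstOrder (trace_mul_firstOrder_eq_zero)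

variable {b : ℕ}

/-! ## §1 Coorbit orthogonality -/

/-- Powers `k ≥ 1` of a matrix with `X ^ H = 0` are traceless. -/
theorem trace_pow_eq_zero_of_pow_eq_zero {X : Matrix (Fin b) (Fin b) ℂ} {H : ℕ} (h : X ^ H = 0) (k : ℕ) (hk : 1 ≤ k) :
    Matrix.trace (X ^ k) = 0 := by
  have hnil : IsNilpotent (X ^ k) := by
    refine ⟨H, ?_⟩
    rw [← pow_mul, mul_comm, pow_mul, h, zero_pow (by omega)]
  exact (Matrix.isNilpotent_trace_of_isNilpotent hnil).eq_zero

/-- The trace of `(x fᵀ)·M` is the coorbit pairing `f · (M x)`. -/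
theorem trace_vecMulVec_mul (x f : Fin b → ℂ) (M : Matrix (Fin b) (Fin b) ℂ) :
    Matrix.trace (vecMulVec x f * M) = f ⬝ᵥ (M *ᵥ x) := by
  rw [vecMulVec_mul, trace_vecMulVec, dotProduct_mulVec, dotProduct_comm]

/-- ★ **COORBIT ORTHOGONALITY** (dSP 2019 Lemma 3.1 for `k ≤ 1`, Claim 3.3 in general).  In a nilpotent space `V ≤ M_b(ℂ)` of uniform index
`≤ H`: if the rank-one matrix `vecMulVec x f = x fᵀ` lies in `V`, then `f · (X^k x) = 0` for every `X ∈ V` and every `k ≥ 0` — the coorbit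
functionals of `x` kill the power orbit of `x`. [cite: deSeguinsPazzis2019StructuredGerstenhaberII, Lemma 3.1 and Claim 3.3] -/
theorem dotProduct_pow_mulVec_eq_zero (V : Submodule ℂ (Matrix (Fin b) (Fin b) ℂ)) {H : ℕ} (hV : ∀ X ∈ V, X ^ H = 0)
    {x f : Fin b → ℂ} (hxf : vecMulVec x f ∈ V) {X : Matrix (Fin b) (Fin b) ℂ} (hX : X ∈ V) (k : ℕ) :
    f ⬝ᵥ (X ^ k *ᵥ x) = 0 := by
  rw [← trace_vecMulVec_mul]
  rcases Nat.eq_zero_or_pos k with rfl | hk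
  · rw [pow_zero, Matrix.mul_one]
    have h := trace_pow_eq_zero_of_pow_eq_zero (hV _ hxf) 1 le_rfl
    rwa [pow_one] at h
  · have h := trace_firstOrder_eq_zero X (vecMulVec x f) (m := k + 1) (by omega) fun y =>
      trace_pow_eq_zero_of_pow_eq_zero (hV _ (V.add_mem hX (V.smul_mem y hxf))) (k + 1) (by omega)
    simpa using h

/-- The cases `k = 0, 1` (dSP Lemma 3.1): `f · x = 0` and `f · (X x) = 0`. [cite: deSeguinsPazzis2019StructuredGerstenhaberII, Lemma 3.1] -/
theorem dotProduct_eq_zero_and_dotProduct_mulVec_eq_zero (V : Submodule ℂ (Matrix (Fin b) (Fin b) ℂ)) {H : ℕ}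
    (hV : ∀ X ∈ V, X ^ H = 0) {x f : Fin b → ℂ} (hxf : vecMulVec x f ∈ V) {X : Matrix (Fin b) (Fin b) ℂ} (hX : X ∈ V) :
    f ⬝ᵥ x = 0 ∧ f ⬝ᵥ (X *ᵥ x) = 0 := by
  refine ⟨?_, ?_⟩
  · have h := dotProduct_pow_mulVec_eq_zero V hV hxf hX 0
    rwa [pow_zero, Matrix.one_mulVec] at h
  · have h := dotProduct_pow_mulVec_eq_zero V hV hxf hX 1
    rwa [pow_one] at h

/-- ★ **FIRST-ORDER COORBIT ORTHOGONALITY**: `f · ((Σ_{i<m} X^i Y X^{m−1−i}) x) = 0` for `X, Y ∈ V` when `x fᵀ ∈ V` (the `z`-derivative of the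
power orbit of `x` under `X + zY`). [cite: deSeguinsPazzis2019StructuredGerstenhaberII, Claim 3.3] -/
theorem dotProduct_derivSum_mulVec_eq_zero (V : Submodule ℂ (Matrix (Fin b) (Fin b) ℂ)) {H : ℕ} (hV : ∀ X ∈ V, X ^ H = 0)
    {x f : Fin b → ℂ} (hxf : vecMulVec x f ∈ V) {X Y : Matrix (Fin b) (Fin b) ℂ} (hX : X ∈ V) (hY : Y ∈ V) (m : ℕ) :
    f ⬝ᵥ ((∑ i ∈ Finset.range m, X ^ i * Y * X ^ (m - 1 - i)) *ᵥ x) = 0 := by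
  rw [← trace_vecMulVec_mul]
  refine trace_mul_firstOrder_eq_zero (vecMulVec x f) X Y m fun z => ?_
  rw [trace_vecMulVec_mul]
  exact dotProduct_pow_mulVec_eq_zero V hV hxf (V.add_mem hX (V.smul_mem z hY)) m

/-! ## §2 MacDonald's inequality `dim V^x + dim (ℂx + V·x) ≤ b` -/

/-- ★★ **MACDONALD'S INEQUALITY** (dSP 2019 §3.1).  In a nilpotent space `V ≤ M_b(ℂ)` of uniform index `≤ H`, for every vector `x`, every
subspace `F ≤ ℂ^b` of coorbit functionals (`x fᵀ ∈ V` for all `f ∈ F`) and the orbit span `G = span({x} ∪ {X x : X ∈ V})`: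
`dim F + dim G ≤ b`. [cite: deSeguinsPazzis2019StructuredGerstenhaberII, Lemma 3.1] -/
theorem finrank_coorbit_add_finrank_orbit_le (V : Submodule ℂ (Matrix (Fin b) (Fin b) ℂ)) {H : ℕ} (hV : ∀ X ∈ V, X ^ H = 0)
    (x : Fin b → ℂ) (F : Submodule ℂ (Fin b → ℂ)) (hF : ∀ f ∈ F, vecMulVec x f ∈ V) :
    Module.finrank ℂ F +
        Module.finrank ℂ (Submodule.span ℂ (insert x ((fun X : Matrix (Fin b) (Fin b) ℂ => X *ᵥ x) '' (V : Set _)))) ≤ b := by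
  classical
  set G := Submodule.span ℂ (insert x ((fun X : Matrix (Fin b) (Fin b) ℂ => X *ᵥ x) '' (V : Set (Matrix (Fin b) (Fin b) ℂ))))
    with hG
  set φ := (dotProductEquiv ℂ (Fin b) : (Fin b → ℂ) ≃ₗ[ℂ] Module.Dual ℂ (Fin b → ℂ)) with hφ
  -- `F` lands in the dual annihilator of `G`
  have hle : F.map (φ : (Fin b → ℂ) →ₗ[ℂ] Module.Dual ℂ (Fin b → ℂ)) ≤ G.dualAnnihilator := by
    rintro _ ⟨f, hf, rfl⟩
    rw [Submodule.mem_dualAnnihilator]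
    intro w hw
    change (φ f) w = 0
    have hker : G ≤ LinearMap.ker (φ f) := by
      rw [hG, Submodule.span_le]
      rintro w (rfl | ⟨X, hX, rfl⟩)
      · change (φ f) w = 0
        rw [hφ, dotProductEquiv_apply_apply]
        obtain ⟨h0, -⟩ := dotProduct_eq_zero_and_dotProduct_mulVec_eq_zero V hV (hF f hf) (V.zero_mem) (X := 0)
        exact h0
      · change (φ f) (X *ᵥ x) = 0
        rw [hφ, dotProductEquiv_apply_apply]
        exact (dotProduct_eq_zero_and_dotProduct_mulVec_eq_zero V hV (hF f hf) hX).2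
    exact hker hw
  have h1 : Module.finrank ℂ (F.map (φ : (Fin b → ℂ) →ₗ[ℂ] Module.Dual ℂ (Fin b → ℂ))) = Module.finrank ℂ F :=
    LinearEquiv.finrank_map_eq φ F
  have h2 := Submodule.finrank_mono hle
  have h3 := Subspace.finrank_add_finrank_dualAnnihilator_eq G
  rw [Module.finrank_fin_fun] at h3
  omega

/-! ## §3 Junction with the top-image laws -/

/-- ★ Under condition (C) of the Reducibility Lemma (✓ `NilSpaceTopImage.mulVec_top_eq_zero_of_topSpan_le`: every member of a subspace `K`
is `c·x + X·x`, `X ∈ V`), the coorbit functionals of `x` kill all of `K`. [cite: deSeguinsPazzis2019StructuredGerstenhaberII, Lemma 3.1] -/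
theorem dotProduct_eq_zero_of_topSpan_generated (V : Submodule ℂ (Matrix (Fin b) (Fin b) ℂ)) {H : ℕ} (hV : ∀ X ∈ V, X ^ H = 0)
    {x f : Fin b → ℂ} (hxf : vecMulVec x f ∈ V) (K : Submodule ℂ (Fin b → ℂ))
    (hC : ∀ w ∈ K, ∃ (c : ℂ) (X : Matrix (Fin b) (Fin b) ℂ), X ∈ V ∧ w = c • x + X *ᵥ x) :
    ∀ w ∈ K, f ⬝ᵥ w = 0 := by
  intro w hw
  obtain ⟨c, X, hX, rfl⟩ := hC w hw
  obtain ⟨h0, h1⟩ := dotProduct_eq_zero_and_dotProduct_mulVec_eq_zero V hV hxf hX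
  rw [dotProduct_add, dotProduct_smul, h0, h1, smul_zero, add_zero]

end Summit.ValiantsHypothesis.ValiantsHypothesis.Theorems.GrenetZeon.NilSpaceCoorbit

end
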